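import Summits.ResolutionOfSingularities.ResolutionOfSingularities.Theorems.FrobeniusClosingPatchingRelPerfectDepthPhaseCX3Defs
import HarnessLib

/-!
# Crux `PatchingRelPerfect` (stmt-ResolutionOfSingularities-16161), chain W5.2 — F7(β) (β-AX) C-I: the `hCure` FRONT-END, V-PART —
# local END on the cylinder region and the closed non-END locus

[OURS · L1 W5.2 · F7(β) (β-AX) X3 C-I (res-L1-w52-lead-1 RECORD R13-1 (3): `…DepthPhaseCEndOnCylinder`, the `hend` input of the (A′) pieces
bridge `goodEnd_of_closedPieces` on the cylinder region)] Fact-free; def-free; NOT statements of the manuscript under review (Hironaka 2017);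
AI-written, weaker than expert review.

* `isOpen_setOf_isEndNear`, `isClosed_support_inter_not_isEndNear` — local END is an OPEN condition (the presentation open serves all its points);
  the non-END locus `N := cosupp K ∩ {x | ¬ IsEndNear K 𝓛 x}` is CLOSED.
* `isEndNear_of_isFormatSncOn`, `isEndNear_residual_of_isFormatSncOn` — a state with a summand, format-snc END on an open `U` (T2c on `cyl.V`),
  is locally END at every point of `U`, for `K` and for the residual `K♭`, with letters `𝓒 ++ S.𝓔` (E1΄s presentation: members
  `(𝓒 ++ S.𝓔) ++ S.𝓔`, rows `𝓗 i ++ exps i`).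

## References
* E. Bierstone, D. Grigoriev, P. Milman, J. Włodarczyk (2011), Def. 3.1.1, Def. 3.1.3. [BierstoneGrigorievMilmanWlodarczyk2011]
* J. Kollár, *Lectures on Resolution of Singularities* (2007), (3.111) Step 3. [Kollar2007]
-/

-- `Summit.<Summit>.<Sub>.Theorems` with `Sub = Summit` (single-conjunct summit, D-0017)
set_option linter.dupNamespace false

noncomputable section

open CategoryTheory CategoryTheory.Limits AlgebraicGeometry TopologicalSpace IsLocalRing
open Literature.AlgebraicGeometry.Resolution Scheme.IdealSheafData

namespace Summit.ResolutionOfSingularities.ResolutionOfSingularities.Theorems.X3LemmaM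

open DepthMultiHost

universe u

variable {X : Scheme.{u}}

/-! ## §1 Local END is an open condition; the non-END locus is closed -/

/-- A local monomial presentation at `x` serves every point of its open. [folklore] -/
theorem IsMonomialNear.of_mem {K : X.IdealSheafData} {Λ : List X.IdealSheafData} {U : X.Opens}
    (hsnc : HasSNC (Λ.map fun F => F.comap U.ι)) {𝒦 : List (List (X.IdealSheafData × ℕ))} (hbd : ∀ L ∈ 𝒦, boundaryOf L = Λ)
    (hne : 𝒦 ≠ []) (hK : K.comap U.ι = (DepthTargets.monomialSum 𝒦).comap U.ι) {y : X} (hy : y ∈ (U : Set X)) :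
    IsMonomialNear K Λ y :=
  ⟨U, hy, hsnc, 𝒦, hbd, hne, hK⟩

/-- **Local END is an OPEN condition**: `{x | IsEndNear K 𝓛 x}` is open. [folklore] -/
theorem isOpen_setOf_isEndNear (K : X.IdealSheafData) (𝓛 : List X.IdealSheafData) : IsOpen {x : X | IsEndNear K 𝓛 x} := by
  rw [isOpen_iff_forall_mem_open]
  rintro x ⟨Λ, hΛ, U, hxU, hsnc, 𝒦, hbd, hne, hK⟩
  exact ⟨U, fun y hy => ⟨Λ, hΛ, IsMonomialNear.of_mem hsnc hbd hne hK hy⟩, U.2, hxU⟩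

/-- **The non-END locus is CLOSED**: `N := cosupp K ∩ {x | ¬ IsEndNear K 𝓛 x}`. [folklore] -/
theorem isClosed_support_inter_not_isEndNear (K : X.IdealSheafData) (𝓛 : List X.IdealSheafData) :
    IsClosed ((K.support : Set X) ∩ {x : X | ¬ IsEndNear K 𝓛 x}) := by
  refine K.support.isClosed.inter ?_
  rw [← isOpen_compl_iff]
  convert isOpen_setOf_isEndNear K 𝓛 using 1
  ext x
  simp

/-- The non-END locus as a `Closeds`. [folklore] -/
theorem exists_closeds_eq_support_inter_not_isEndNear (K : X.IdealSheafData) (𝓛 : List X.IdealSheafData) :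
    ∃ N : Closeds X, (N : Set X) = (K.support : Set X) ∩ {x : X | ¬ IsEndNear K 𝓛 x} :=
  ⟨⟨_, isClosed_support_inter_not_isEndNear K 𝓛⟩, rfl⟩

/-! ## §2 Format-snc END on the cylinder region is local END there (for `K` and for `K♭`) -/

section Format

variable {S : MultiHostState X} {U : X.Opens} {𝓒 : List X.IdealSheafData} {𝓗 : Fin S.n → List (X.IdealSheafData × ℕ)}

/-- **Format-snc END on `U` ⇒ local END of `K` at every point of `U`**, letters `𝓒 ++ S.𝓔` (E1΄s presentation read pointwise).
[cite: Kollar2007, (3.111) Step 3] -/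
theorem isEndNear_of_isFormatSncOn (h : S.IsFormatSncOn U 𝓒 𝓗) (hn : S.n ≠ 0) {x : X} (hx : x ∈ (U : Set X)) :
    IsEndNear S.K (𝓒 ++ S.𝓔) x := by
  refine ⟨(𝓒 ++ S.𝓔) ++ S.𝓔, fun F hF => ?_, U, hx, h.hasSNC_append, List.ofFn fun i => 𝓗 i ++ S.exps i,
    fun _ hL => h.boundaryOf_of_mem_ofFn hL, fun he => hn (List.ofFn_eq_nil_iff.mp he), h.comap_K⟩
  rcases List.mem_append.mp hF with hF | hF
  · exact hF
  · exact List.mem_append_right _ hF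

/-- **Format-snc END on `U` ⇒ local END of the RESIDUAL `K♭` at every point of `U`**, letters `𝓒 ++ S.𝓔` (format-snc END does not see the
exponents, `isFormatSncOn_residual_iff`). On the cylinder region `U := cyl.V` this is the `hend` input of the pieces bridge.
[cite: Kollar2007, (3.111) Step 3] -/
theorem isEndNear_residual_of_isFormatSncOn (h : S.IsFormatSncOn U 𝓒 𝓗) (hn : S.n ≠ 0) {x : X} (hx : x ∈ (U : Set X)) :
    IsEndNear S.residual.K (𝓒 ++ S.𝓔) x :=
  isEndNear_of_isFormatSncOn (S := S.residual) ((S.isFormatSncOn_residual_iff U 𝓒 𝓗).mpr h) hn hx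

/-- The same at every point of `U ∩ cosupp K♭` (the shape used by the bridge). [folklore] -/
theorem isEndNear_residual_of_isFormatSncOn_of_mem_support (h : S.IsFormatSncOn U 𝓒 𝓗) (hn : S.n ≠ 0) :
    ∀ x ∈ (U : Set X), x ∈ (S.residual.K.support : Set X) → IsEndNear S.residual.K (𝓒 ++ S.𝓔) x :=
  fun _ hx _ => isEndNear_residual_of_isFormatSncOn h hn hx

end Format

end Summit.ResolutionOfSingularities.ResolutionOfSingularities.Theorems.X3LemmaM

end
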